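import Summits.QuantumFields.YangMills.Theorems.WeakCouplingRatesColdBoxPlaqVariance
import Literature.Probability.Distributions.MultivariateGaussianWick
import HarnessLib

/-!
# Stub C of LINE-17 (`DirFreeVarLinear`, crux `AllWindowsColdBox.BoxMidWindowsSU22`, stmt-QuantumFields-24003) — part 1:
# Thomson's principle for Chatterjee's pinned lattice-Maxwell precision matrix, and the edge coefficients of 2-chains

For the Dirichlet Gaussian `boxDirichlet H = N(0, Q_D⁻¹)` of the cold-wall box (`Q_D = Σ_p λ_p λ_pᵀ` over the plaquettes `p` of the
enlarged box `{−1,…,2H+1}⁴`, `λ_p ∈ ℝ^{free edges}` the circulation coefficients):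
* `integral_eval_sq_boxDirichlet` — `E_D[s_e²] = (Q_D⁻¹)_{ee}` (tree `GaussianWick.integral_eval_mul_eval_multivariateGaussian`);
* `thomson` / `inv_diag_le_of_chain` — **Thomson's principle**: if a 2-chain `ψ` on the plaquettes of the enlarged box has free
  boundary `Σ_p ψ_p λ_p = v` then `vᵀ Q⁻¹ v ≤ Σ_p ψ_p²` (with `w = Q⁻¹v`: `v·w = Σ_p ψ_p (λ_p·w) ≤ ‖ψ‖ (wᵀQw)^{1/2} = ‖ψ‖ (v·w)^{1/2}`);
  in particular `(Q⁻¹)_{ee} ≤ ‖ψ‖²` whenever the free boundary of `ψ` is the single edge `e`;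
* `chainCoeff_single` — the free boundary of one plaquette `q₀` is `e' ↦ coeffAux e' q₀`;
* `chainCoeff_temporal` — the free boundary of a TEMPORAL 2-chain `ψ(x, 0, k) = w x k`: on a temporal edge `(z, e₀)` it is the
  spatial divergence `Σ_k (w z k − w (z − e_k) k)`, on a spatial edge `(z, i)` it is `w (z − e₀) i − w z i`.
These are the tools of the per-edge chains of part 2 (`…DirFreeVarChains`) and of the Pólya octant flow (`…DirFreeVarOctantFlow`).
Def-free; Mathlib + the tree's `LatticeMaxwellGaussian` / `WeakCouplingRatesDefs` API only.

HONEST LABEL: linear-algebra helpers for ONE registered stub of two critic-PASSed lines on the R2ξ″ RECORD-rung cruxes 24003/24006;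
no crux, rung or summit is proved; the Yang–Mills mass gap is NOT proved by this file.
-/

set_option autoImplicit false

noncomputable section

open MeasureTheory Matrix Finset
open Literature.MathematicalPhysics.QuantumFieldTheory
open Literature.MathematicalPhysics.QuantumFieldTheory.LatticeMaxwell
open Literature.MathematicalPhysics.QuantumFieldTheory.AxialGauge
open Literature.Probability.LatticeModels (Site halfOpenBox mem_halfOpenBox)
open Summit.QuantumFields.YangMills.Theorems.WeakCouplingRates

namespace Summit.QuantumFields.YangMills.Theorems.AllWindowsColdBoxDirFreeVar

/-! ## 1. The variance of a free edge variable is the diagonal of `Q_D⁻¹` -/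

/-- `E_D[s_e²] = (Q_D⁻¹)_{ee}` for the Dirichlet Gaussian `boxDirichlet H = N(0, Q_D⁻¹)`. -/
theorem integral_eval_sq_boxDirichlet (H : ℕ) (e : DirFree H) :
    ∫ s, (WithLp.ofLp s e) ^ 2 ∂(boxDirichlet H) =
      (Qmat (fun e => e ∉ dirFreeEdges H) dirCorner (2 * H + 3))⁻¹ e e := by
  have h := Literature.Probability.Distributions.GaussianWick.integral_eval_mul_eval_multivariateGaussian
    (posDef_dirQmat H).inv.posSemidef e e
  simp_rw [← sq] at h
  exact h

/-! ## 2. Thomson's principle for `Q = Σ_p λ_p λ_pᵀ` -/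

section Thomson

variable {d : ℕ} {pin : Literature.MathematicalPhysics.QuantumLattice.ZdEdge d → Prop} [DecidablePred pin]
  {a : Site d} {n : ℕ}

/-- `(Σ_p f p) · w = Σ_p (f p · w)`. -/
theorem sum_dotProduct_left {ι : Type*} (S : Finset ι) (f : ι → Free pin a n → ℝ) (w : Free pin a n → ℝ) :
    (∑ p ∈ S, f p) ⬝ᵥ w = ∑ p ∈ S, f p ⬝ᵥ w := by
  classical
  induction S using Finset.induction_on with
  | empty => simp
  | insert x S hx ih => rw [Finset.sum_insert hx, Finset.sum_insert hx, add_dotProduct, ih]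

/-- **Thomson's principle.**  For positive definite `Q = Σ_{p} λ_p λ_pᵀ` (Chatterjee's `Qmat pin a n`, the sum over the plaquettes
`p` of the box, `λ_p = coeff (a + p)`) and any 2-chain `ψ` with free boundary `Σ_p ψ_p λ_p = v`: `vᵀ Q⁻¹ v ≤ Σ_p ψ_p²`. -/
theorem thomson (hQ : (Qmat pin a n).PosDef) (ψ : Plaq d → ℝ) (v : Free pin a n → ℝ)
    (hv : ∑ p ∈ plaquettesIn (halfOpenBox d n), ψ (Plaq.shift a p) • coeff pin a n (Plaq.shift a p) = v) :
    v ⬝ᵥ (Qmat pin a n)⁻¹ *ᵥ v ≤ ∑ p ∈ plaquettesIn (halfOpenBox d n), ψ (Plaq.shift a p) ^ 2 := by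
  classical
  set w := (Qmat pin a n)⁻¹ *ᵥ v with hw
  have hQw : Qmat pin a n *ᵥ w = v := by
    rw [hw, mulVec_mulVec, mul_nonsing_inv _ ((isUnit_iff_isUnit_det _).1 hQ.isUnit), one_mulVec]
  -- `v · w = wᵀ Q w = Σ_p (λ_p · w)²`
  have hform : v ⬝ᵥ w = ∑ p ∈ plaquettesIn (halfOpenBox d n), (coeff pin a n (Plaq.shift a p) ⬝ᵥ w) ^ 2 := by
    rw [← formM_zero_eq, ← dotProduct_Qmat_mulVec, hQw, dotProduct_comm]
  -- `v · w = Σ_p ψ_p (λ_p · w)`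
  have hlin : v ⬝ᵥ w = ∑ p ∈ plaquettesIn (halfOpenBox d n), ψ (Plaq.shift a p) * (coeff pin a n (Plaq.shift a p) ⬝ᵥ w) := by
    rw [← hv, sum_dotProduct_left]
    refine Finset.sum_congr rfl fun p _ => ?_
    rw [smul_dotProduct, smul_eq_mul]
  have hx0 : 0 ≤ v ⬝ᵥ w := by rw [hform]; exact Finset.sum_nonneg fun p _ => sq_nonneg _
  have hS0 : 0 ≤ ∑ p ∈ plaquettesIn (halfOpenBox d n), ψ (Plaq.shift a p) ^ 2 := Finset.sum_nonneg fun p _ => sq_nonneg _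
  -- Cauchy–Schwarz: `(v·w)² ≤ ‖ψ‖² · (v·w)`
  have hcs : (v ⬝ᵥ w) ^ 2 ≤ (∑ p ∈ plaquettesIn (halfOpenBox d n), ψ (Plaq.shift a p) ^ 2) * (v ⬝ᵥ w) := by
    have h := Finset.sum_mul_sq_le_sq_mul_sq (plaquettesIn (halfOpenBox d n)) (fun p => ψ (Plaq.shift a p))
      (fun p => coeff pin a n (Plaq.shift a p) ⬝ᵥ w)
    rw [← hlin, ← hform] at h
    exact h
  rcases hx0.lt_or_eq with hpos | hzero
  · exact le_of_mul_le_mul_right (by nlinarith [hcs]) hpos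
  · rw [← hzero]; exact hS0

/-- **Thomson's principle, diagonal form**: if the free boundary of the 2-chain `ψ` is the single free edge `e`
(`Σ_p ψ_p λ_p = δ_e`) then `(Q⁻¹)_{ee} ≤ Σ_p ψ_p²`. -/
theorem inv_diag_le_of_chain (hQ : (Qmat pin a n).PosDef) (ψ : Plaq d → ℝ) (e : Free pin a n)
    (hv : ∀ e' : Free pin a n,
      (∑ p ∈ plaquettesIn (halfOpenBox d n), ψ (Plaq.shift a p) • coeff pin a n (Plaq.shift a p) : Free pin a n → ℝ) e' =
      if e' = e then 1 else 0) :
    (Qmat pin a n)⁻¹ e e ≤ ∑ p ∈ plaquettesIn (halfOpenBox d n), ψ (Plaq.shift a p) ^ 2 := by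
  classical
  have hv' : ∑ p ∈ plaquettesIn (halfOpenBox d n), ψ (Plaq.shift a p) • coeff pin a n (Plaq.shift a p) = Pi.single e 1 := by
    funext e'
    rw [hv e', Pi.single_apply]
  have h := thomson hQ ψ (Pi.single e 1) hv'
  rwa [mulVec_single_one, single_one_dotProduct] at h

/-! ## 3. The free boundary of a 2-chain, edge by edge -/

omit [DecidablePred pin] in
/-- The free-boundary vector of a 2-chain, evaluated at a free edge `e'`: `Σ_p Φ_p · coeffAux e' (a + p)`. -/
theorem chainVec_apply (Φ : Plaq d → ℝ) (e' : Free pin a n) :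
    (∑ p ∈ plaquettesIn (halfOpenBox d n), Φ p • coeff pin a n (Plaq.shift a p) : Free pin a n → ℝ) e' =
      ∑ p ∈ plaquettesIn (halfOpenBox d n), Φ p * coeffAux e'.1.1 (Plaq.shift a p) := by
  rw [Finset.sum_apply]
  refine Finset.sum_congr rfl fun p _ => ?_
  rw [Pi.smul_apply, smul_eq_mul, coeff]

/-- `Plaq.shift a (Plaq.shift (−a) q) = q`. -/
theorem shift_shift_neg (q : Plaq d) : Plaq.shift a (Plaq.shift (-a) q) = q := by
  obtain ⟨x, i, j⟩ := q
  simp [Plaq.shift]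

/-- `Plaq.shift (−a) (Plaq.shift a p) = p`. -/
theorem shift_neg_shift (p : Plaq d) : Plaq.shift (-a) (Plaq.shift a p) = p := by
  obtain ⟨x, i, j⟩ := p
  simp [Plaq.shift]

/-- **Fiber sums.**  For an injective family `g : Fin d → Plaq d` parametrising exactly the plaquettes with property `Pq`, and
`F` vanishing at every `g k` outside the (shifted) index set: `Σ_p F(a+p)·[Pq (a+p)] = Σ_k F (g k)`. -/
theorem sum_mul_ite_eq_sum_fiber (F : Plaq d → ℝ) (Pq : Plaq d → Prop) [DecidablePred Pq] (g : Fin d → Plaq d)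
    (hg : Function.Injective g) (hP : ∀ q, Pq q ↔ ∃ k, q = g k)
    (hsupp : ∀ k, F (g k) ≠ 0 → Plaq.shift (-a) (g k) ∈ plaquettesIn (halfOpenBox d n)) :
    ∑ p ∈ plaquettesIn (halfOpenBox d n), F (Plaq.shift a p) * (if Pq (Plaq.shift a p) then 1 else 0) = ∑ k, F (g k) := by
  classical
  set P := plaquettesIn (halfOpenBox d n) with hPdef
  -- left: a sum over the filter
  have hL : ∑ p ∈ P, F (Plaq.shift a p) * (if Pq (Plaq.shift a p) then 1 else 0) =
      ∑ p ∈ P.filter (fun p => Pq (Plaq.shift a p)), F (Plaq.shift a p) := by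
    rw [Finset.sum_filter]
    refine Finset.sum_congr rfl fun p _ => ?_
    split_ifs <;> simp
  -- right: a sum over the `k` with `g k` in range, then an image
  set K := (Finset.univ : Finset (Fin d)).filter (fun k => Plaq.shift (-a) (g k) ∈ P) with hKdef
  have hR : ∑ k, F (g k) = ∑ k ∈ K, F (g k) := by
    symm
    refine Finset.sum_subset (Finset.filter_subset _ _) fun k _ hk => ?_
    by_contra hne
    exact hk (Finset.mem_filter.2 ⟨Finset.mem_univ _, hsupp k hne⟩)
  have hinj : Set.InjOn (fun k => Plaq.shift (-a) (g k)) K := by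
    intro k _ k' _ hkk'
    have : g k = g k' := by
      have := congrArg (Plaq.shift a) hkk'
      simpa only [shift_shift_neg] using this
    exact hg this
  have hKimage : P.filter (fun p => Pq (Plaq.shift a p)) = K.image (fun k => Plaq.shift (-a) (g k)) := by
    ext p
    simp only [Finset.mem_filter, Finset.mem_image, hKdef, Finset.mem_univ, true_and]
    constructor
    · rintro ⟨hp, hPq⟩
      obtain ⟨k, hk⟩ := (hP _).1 hPq
      refine ⟨k, ?_, ?_⟩
      · rw [← hk, shift_neg_shift]; exact hp
      · rw [← hk, shift_neg_shift]
    · rintro ⟨k, hk, rfl⟩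
      refine ⟨hk, ?_⟩
      rw [shift_shift_neg]
      exact (hP _).2 ⟨k, rfl⟩
  rw [hL, hR, hKimage, Finset.sum_image hinj]
  refine Finset.sum_congr rfl fun k _ => ?_
  rw [shift_shift_neg]

/-- The four fiber sums of `coeffAux`: `Σ_p F(a+p) · coeffAux (z,i) (a+p) = Σ_k F(z,i,k) + Σ_j F(z−e_j,j,i) − Σ_k F(z−e_k,i,k)
− Σ_j F(z,j,i)` for `F` vanishing off the (shifted) index set. -/
theorem sum_mul_coeffAux (F : Plaq d → ℝ)
    (hsupp : ∀ q, F q ≠ 0 → Plaq.shift (-a) q ∈ plaquettesIn (halfOpenBox d n)) (z : Site d) (i : Fin d) :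
    ∑ p ∈ plaquettesIn (halfOpenBox d n), F (Plaq.shift a p) * coeffAux (z, i) (Plaq.shift a p) =
      (∑ k : Fin d, F (z, i, k)) + (∑ j : Fin d, F (z - Pi.single j 1, j, i)) -
        (∑ k : Fin d, F (z - Pi.single k 1, i, k)) - ∑ j : Fin d, F (z, j, i) := by
  classical
  have e4 : ∀ p, F (Plaq.shift a p) * coeffAux (z, i) (Plaq.shift a p) =
      F (Plaq.shift a p) * (if (z, i) = ((Plaq.shift a p).1, (Plaq.shift a p).2.1) then 1 else 0) +
      F (Plaq.shift a p) * (if (z, i) = ((Plaq.shift a p).1 + Pi.single (Plaq.shift a p).2.1 1, (Plaq.shift a p).2.2) then 1 else 0) -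
      F (Plaq.shift a p) * (if (z, i) = ((Plaq.shift a p).1 + Pi.single (Plaq.shift a p).2.2 1, (Plaq.shift a p).2.1) then 1 else 0) -
      F (Plaq.shift a p) * (if (z, i) = ((Plaq.shift a p).1, (Plaq.shift a p).2.2) then 1 else 0) := fun p => by
    rw [coeffAux]; ring
  simp_rw [e4]
  rw [Finset.sum_sub_distrib, Finset.sum_sub_distrib, Finset.sum_add_distrib]
  -- term 1: `q = (z, i, k)`
  rw [sum_mul_ite_eq_sum_fiber F (fun q => (z, i) = (q.1, q.2.1)) (fun k => (z, i, k))
      (fun k k' h => by simpa using h)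
      (fun q => ⟨fun h => ⟨q.2.2, by obtain ⟨x, j, k⟩ := q; simp only [Prod.mk.injEq] at h; simp [h.1, h.2]⟩,
        fun ⟨k, hk⟩ => by subst hk; rfl⟩)
      (fun k hk => hsupp _ hk)]
  -- term 2: `q = (z - e_j, j, i)`
  rw [sum_mul_ite_eq_sum_fiber F (fun q => (z, i) = (q.1 + Pi.single q.2.1 1, q.2.2)) (fun j => (z - Pi.single j 1, j, i))
      (fun j j' h => by simpa using (Prod.mk.inj h).2)
      (fun q => ⟨fun h => ⟨q.2.1, by
          obtain ⟨x, j, k⟩ := q; simp only [Prod.mk.injEq] at h; refine Prod.ext ?_ (by simp [h.2]); simp [h.1]⟩,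
        fun ⟨j, hj⟩ => by subst hj; simp⟩)
      (fun k hk => hsupp _ hk)]
  -- term 3: `q = (z - e_k, i, k)`
  rw [sum_mul_ite_eq_sum_fiber F (fun q => (z, i) = (q.1 + Pi.single q.2.2 1, q.2.1)) (fun k => (z - Pi.single k 1, i, k))
      (fun k k' h => by simpa using (Prod.mk.inj (Prod.mk.inj h).2).2)
      (fun q => ⟨fun h => ⟨q.2.2, by
          obtain ⟨x, j, k⟩ := q; simp only [Prod.mk.injEq] at h; refine Prod.ext ?_ (by simp [h.2]); simp [h.1]⟩,
        fun ⟨k, hk⟩ => by subst hk; simp⟩)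
      (fun k hk => hsupp _ hk)]
  -- term 4: `q = (z, j, i)`
  rw [sum_mul_ite_eq_sum_fiber F (fun q => (z, i) = (q.1, q.2.2)) (fun j => (z, j, i))
      (fun j j' h => by simpa using (Prod.mk.inj (Prod.mk.inj h).2).1)
      (fun q => ⟨fun h => ⟨q.2.1, by obtain ⟨x, j, k⟩ := q; simp only [Prod.mk.injEq] at h; simp [h.1, h.2]⟩,
        fun ⟨j, hj⟩ => by subst hj; rfl⟩)
      (fun k hk => hsupp _ hk)]

omit [DecidablePred pin] in
/-- **Free boundary of a single plaquette**: for `q₀` in the enlarged box and a constant `c`, the chain `c·𝟙_{q₀}` has free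
boundary `e' ↦ c · coeffAux e' q₀`. -/
theorem chainCoeff_single (q₀ : Plaq d) (hq₀ : Plaq.shift (-a) q₀ ∈ plaquettesIn (halfOpenBox d n)) (c : ℝ) (e' : Free pin a n) :
    (∑ p ∈ plaquettesIn (halfOpenBox d n), (if Plaq.shift a p = q₀ then c else 0) • coeff pin a n (Plaq.shift a p) :
      Free pin a n → ℝ) e' =
      c * coeffAux e'.1.1 q₀ := by
  classical
  rw [chainVec_apply, Finset.sum_eq_single (Plaq.shift (-a) q₀)]
  · rw [shift_shift_neg, if_pos rfl]
  · intro p _ hp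
    rw [if_neg, zero_mul]
    intro h; apply hp; rw [← h, shift_neg_shift]
  · intro h; exact absurd hq₀ h

end Thomson

/-! ## 4. Temporal 2-chains of the cold-wall box -/

section Temporal

variable {H : ℕ}

/-- **Free boundary of a temporal 2-chain.**  For weights `w x k` on the temporal plaquettes `(x, 0, k)` (with `w x 0 = 0`, and
`w x k ≠ 0` only for plaquettes of the enlarged box), the chain `ψ(x, j, k) = [j = 0]·w x k` has free boundary
`Σ_k (w z k − w (z − e_k) k)` at a temporal edge `(z, e₀)` and `w (z − e₀) i − w z i` at a spatial edge `(z, i)`. -/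
theorem chainCoeff_temporal (w : Site 4 → Fin 4 → ℝ) (hw0 : ∀ x, w x 0 = 0)
    (hsupp : ∀ x k, w x k ≠ 0 → Plaq.shift (-dirCorner) (x, 0, k) ∈ plaquettesIn (halfOpenBox 4 (2 * H + 3)))
    (e' : DirFree H) :
    (∑ p ∈ plaquettesIn (halfOpenBox 4 (2 * H + 3)),
        (if (Plaq.shift dirCorner p).2.1 = 0 then w (Plaq.shift dirCorner p).1 (Plaq.shift dirCorner p).2.2 else 0) •
          coeff (fun e => e ∉ dirFreeEdges H) dirCorner (2 * H + 3) (Plaq.shift dirCorner p) : DirFree H → ℝ) e' =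
      if e'.1.1.2 = 0 then ∑ k : Fin 4, (w e'.1.1.1 k - w (e'.1.1.1 - Pi.single k 1) k)
      else w (e'.1.1.1 - Pi.single 0 1) e'.1.1.2 - w e'.1.1.1 e'.1.1.2 := by
  classical
  set F : Plaq 4 → ℝ := fun q => if q.2.1 = 0 then w q.1 q.2.2 else 0 with hF
  have hFsupp : ∀ q, F q ≠ 0 → Plaq.shift (-dirCorner) q ∈ plaquettesIn (halfOpenBox 4 (2 * H + 3)) := by
    intro q hq
    obtain ⟨x, j, k⟩ := q
    simp only [hF] at hq
    split_ifs at hq with hj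
    · subst hj; exact hsupp x k hq
    · exact absurd rfl hq
  obtain ⟨⟨⟨z, i⟩, hmem⟩, hfree⟩ := e'
  rw [chainVec_apply]
  change ∑ p ∈ plaquettesIn (halfOpenBox 4 (2 * H + 3)), F (Plaq.shift dirCorner p) * coeffAux (z, i) (Plaq.shift dirCorner p) = _
  rw [sum_mul_coeffAux F hFsupp z i]
  simp only [hF]
  by_cases hi : i = 0
  · subst hi
    simp only [if_true, Fin.sum_univ_four, Fin.isValue, hw0]
    simp
    ring
  · simp only [hi, if_false, Finset.sum_const_zero, Finset.sum_ite_eq', Finset.mem_univ, if_true, Fin.isValue]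
    ring

end Temporal

end Summit.QuantumFields.YangMills.Theorems.AllWindowsColdBoxDirFreeVar

end
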